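import Summits.RiemannHypothesis.RiemannHypothesis.Theorems.Splittings.SplitXWucStarRowA
import HarnessLib

/-!
# x-wuc GEN-11 row ★₁₀₂₄ʳ — `HSW → K1′ → (RH ⟺ RH(e^1024) ∧ B′₁([−1,1]))` — tree port, part B (2/4)

Part B: `ordinateBandL_of_hsw` (HSW zero counting ⟹ the ordinate band), `rh_iff_rhUpTo_and_boundedAwayAt_of_hswL`, the HSW arithmetic `hswArith_threeHalves_exp1024_L` and rows `rh_iff_rhUpTo_exp1024_and_boundedAwayAt_L` / `_L'` / `_L400`.
Provenance, deltas and HONEST LABEL as in part A (`SplitXWucStarRowA.lean`): declarations verbatim from G11b 3a3eefe13ea0264d,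
re-targeted onto the tree twins; CONDITIONAL bookkeeping; RH is not proved by this; nothing here bears on the truth of RH.
-/

-- D-0017: `Summit.RiemannHypothesis.RiemannHypothesis.…` duplicates the namespace BY DESIGN (single-problem summit).
set_option linter.dupNamespace false
noncomputable section

namespace Summit.RiemannHypothesis.RiemannHypothesis.Theorems.Splittings.XWucG8

open scoped Classical ComplexConjugate InnerProductSpace
open Set Filter Topology Complex MeasureTheory
open Literature.NumberTheory.LFunctions Literature.NumberTheory.LFunctions.Bombieri2000
open Summit.RiemannHypothesis.RiemannHypothesis.Theses.RuelleBand
open Summit.RiemannHypothesis.RiemannHypothesis.Theorems.Splittings.BombieriTruncEigen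
open Summit.RiemannHypothesis.RiemannHypothesis.Theorems.Splittings.BombieriFozNoDep
open Summit.RiemannHypothesis.RiemannHypothesis.Theorems.Splittings.BombieriTruncGram
open Summit.RiemannHypothesis.RiemannHypothesis.Theorems.Splittings.BombieriTruncPairing
open Summit.RiemannHypothesis.RiemannHypothesis.Theorems.Splittings.BombieriTruncScreening
open Summit.RiemannHypothesis.RiemannHypothesis.Theorems.Splittings.BombieriTruncBandGap
open Summit.RiemannHypothesis.RiemannHypothesis.Theorems.Splittings.BombieriTruncMultiplicity
open Summit.RiemannHypothesis.RiemannHypothesis.Theorems.Splittings.BombieriTruncEventualStrip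
open Summit.RiemannHypothesis.RiemannHypothesis.Theorems.Splittings.BombieriTruncExactness
open Summit.RiemannHypothesis.RiemannHypothesis.Theorems.Splittings.BombieriTruncClump
open Summit.RiemannHypothesis.RiemannHypothesis.Theorems.Splittings.BombieriTruncOffLineSparse
open Summit.RiemannHypothesis.RiemannHypothesis.Theorems.Splittings.BombieriTruncSynthesis
open Summit.RiemannHypothesis.RiemannHypothesis.Theorems.Splittings.BombieriTruncSynthesisScreening
open Summit.RiemannHypothesis.RiemannHypothesis.Theorems.Splittings.BombieriTruncSynthesisRows
open Literature.NumberTheory.DiophantineGeometry (RiemannHypothesisUpTo)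
open Summit.RiemannHypothesis.RiemannHypothesis.Theorems.Splittings.BombieriTruncMassAware
open Summit.RiemannHypothesis.RiemannHypothesis.Theorems.Splittings.MassAwareSamplingCeiling
variable {N : ℕ}

/-- **(K-count_L) `OrdinateBandL L T₀ δ` from HSW's explicit `N(T)`**, for every `δ` with `2·q(τ₀ + τ₀/8π) + L/138 ≤ δ·D(τ₀)` (`τ₀ > T₀ ≥ 3`;
density drift `(b − a)·(1/6)·(1/23) ≤ L/138` on windows of length `≤ L`; G8.10 with the cap as a parameter).
[new; conditional on the print fact `zetaZeroCount_hasanalizade_shen_wong` only] -/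
theorem ordinateBandL_of_hsw (h : zetaZeroCount_hasanalizade_shen_wong) {L T₀ δ : ℝ} (hT₀ : 3 ≤ T₀)
    (hδ : ∀ τ₀ : ℝ, T₀ < τ₀ → 2 * FordFarZeros.hswErr (τ₀ + τ₀ / (8 * Real.pi)) + L / 138 ≤ δ * zdens τ₀) :
    OrdinateBandL L T₀ δ := by
  intro τ₀ hτ Λ hΛ hΛcap
  refine ⟨⌈τ₀ + Λ + 2⌉₊, fun N hN a b ha hab hb hlen ↦ ?_⟩
  have hπ := Real.pi_pos
  have hπ3 := Real.pi_gt_three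
  have hτ0 : 0 < τ₀ := by linarith
  have h8π : τ₀ / (8 * Real.pi) ≤ τ₀ / 24 :=
    div_le_div_of_nonneg_left hτ0.le (by norm_num) (by linarith)
  have hΛ24 : Λ ≤ τ₀ / 24 := hΛcap.trans h8π
  have he3 : Real.exp 1 < 2.7182818286 := Real.exp_one_lt_d9
  -- the window in absolute heights
  have ht₁pos : 0 < τ₀ + a := by linarith
  have ht₁e : Real.exp 1 ≤ τ₀ + a := by linarith
  have ht₂e : Real.exp 1 ≤ τ₀ + b := by linarith
  have hNr : (τ₀ + b) + 2 ≤ (N : ℝ) := by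
    have : (⌈τ₀ + Λ + 2⌉₊ : ℝ) ≤ N := by exact_mod_cast hN
    linarith [Nat.le_ceil (τ₀ + Λ + 2)]
  -- slot count = N(τ₀+b) − N(τ₀+a)
  have hfilt : (Finset.univ : Finset (truncIdx N)).filter (fun i ↦ a < tau i - τ₀ ∧ tau i - τ₀ ≤ b) =
      (Finset.univ : Finset (truncIdx N)).filter (fun i ↦ τ₀ + a < tau i ∧ tau i ≤ τ₀ + b) := by
    refine Finset.filter_congr fun i _ ↦ ?_
    constructor <;> rintro ⟨h1, h2⟩ <;> constructor <;> linarith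
  have hcnt := card_slots_window_eq ht₁pos (by linarith : τ₀ + a ≤ τ₀ + b) hNr
  rw [← hfilt] at hcnt
  rw [hcnt]
  -- HSW at both ends
  have hlo₁ := (FordFarZeros.hsw_bounds h ht₁e).1
  have hhi₁ := (FordFarZeros.hsw_bounds h ht₁e).2
  have hlo₂ := (FordFarZeros.hsw_bounds h ht₂e).1
  have hhi₂ := (FordFarZeros.hsw_bounds h ht₂e).2
  have hq₁ : FordFarZeros.hswErr (τ₀ + a) ≤ FordFarZeros.hswErr (τ₀ + τ₀ / (8 * Real.pi)) :=
    FordFarZeros.hswErr_mono ht₁e (by linarith)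
  have hq₂ : FordFarZeros.hswErr (τ₀ + b) ≤ FordFarZeros.hswErr (τ₀ + τ₀ / (8 * Real.pi)) :=
    FordFarZeros.hswErr_mono ht₂e (by linarith)
  -- main-term drift by the mean value theorem
  obtain ⟨ξ, hξ, hξeq⟩ := exists_hasDerivAt_eq_slope FordFarZeros.rvmMain
    (fun ξ ↦ 1 / (2 * Real.pi) * Real.log (ξ / (2 * Real.pi))) (by linarith : τ₀ + a < τ₀ + b)
    (FordFarZeros.continuousOn_rvmMain.mono fun x hx ↦ Set.mem_Ioi.2 (ht₁pos.trans_le hx.1))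
    (fun x hx ↦ FordFarZeros.hasDerivAt_rvmMain (ht₁pos.trans hx.1))
  have hξpos : 0 < ξ := ht₁pos.trans hξ.1
  have hξlo : τ₀ - Λ ≤ ξ := by linarith [hξ.1]
  have hξhi : ξ ≤ τ₀ + Λ := by linarith [hξ.2]
  have hMdiff : FordFarZeros.rvmMain (τ₀ + b) - FordFarZeros.rvmMain (τ₀ + a) =
      (b - a) * (1 / (2 * Real.pi) * Real.log (ξ / (2 * Real.pi))) := by
    have hne : (τ₀ + b) - (τ₀ + a) ≠ 0 := by linarith
    have h' := hξeq
    rw [eq_div_iff hne] at h'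
    rw [← h']
    ring
  have hlogdiff : Real.log (ξ / (2 * Real.pi)) - Real.log (τ₀ / (2 * Real.pi)) = Real.log (ξ / τ₀) := by
    rw [Real.log_div hξpos.ne' (by positivity), Real.log_div hτ0.ne' (by positivity),
      Real.log_div hξpos.ne' hτ0.ne']
    ring
  -- |log(ξ/τ₀)| ≤ 1/23
  have hyup : Real.log (ξ / τ₀) ≤ 1 / 24 := by
    refine (Real.log_le_sub_one_of_pos (div_pos hξpos hτ0)).trans ?_
    rw [div_sub_one hτ0.ne', div_le_iff₀ hτ0]
    linarith
  have hylo : -(1 / 23) ≤ Real.log (ξ / τ₀) := by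
    refine le_trans ?_ (Real.one_sub_inv_le_log_of_pos (div_pos hξpos hτ0))
    rw [inv_div, one_sub_div hξpos.ne', le_div_iff₀ hξpos]
    linarith
  have habs : |Real.log (ξ / τ₀)| ≤ 1 / 23 := abs_le.2 ⟨hylo, by linarith⟩
  have h2π : 1 / (2 * Real.pi) ≤ 1 / 6 := one_div_le_one_div_of_le (by norm_num) (by linarith)
  have hL0 : 0 ≤ L := by linarith
  have hdrift : |(b - a) * (1 / (2 * Real.pi) * Real.log (ξ / τ₀))| ≤ L / 138 := by
    rw [abs_mul, abs_mul, abs_of_pos (by linarith : 0 < b - a), abs_of_pos (by positivity : 0 < 1 / (2 * Real.pi))]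
    calc (b - a) * (1 / (2 * Real.pi) * |Real.log (ξ / τ₀)|)
        ≤ L * (1 / 6 * (1 / 23)) :=
          mul_le_mul hlen (mul_le_mul h2π habs (abs_nonneg _) (by norm_num)) (by positivity) hL0
      _ = L / 138 := by ring
  have hd := abs_le.1 hdrift
  have hkey : FordFarZeros.rvmMain (τ₀ + b) - FordFarZeros.rvmMain (τ₀ + a) - zdens τ₀ * (b - a) =
      (b - a) * (1 / (2 * Real.pi) * Real.log (ξ / τ₀)) := by
    rw [hMdiff, ← hlogdiff]
    unfold zdens
    ring
  have hδτ := hδ τ₀ hτ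
  rw [abs_le]
  constructor <;> linarith [hd.1, hd.2, hkey, hlo₁, hhi₁, hlo₂, hhi₂, hq₁, hq₂, hδτ]

/-- Row **X-7♮♮♮_L (HSW)**: `MassAwareSamplingL L δ θ ∧ (δ·Φ < 8πθ) ∧ HSW ∧ (2q(τ₀(1+1/8π)) + L/138 ≤ δ·D(τ₀) for τ₀ > T₀) ∧ T₀ ≥ 2π e^{2π}`
⟹ `RH ⟺ RH(T₀) ∧ B′₁([−1,1])`. [new; conditional bookkeeping] -/
theorem rh_iff_rhUpTo_and_boundedAwayAt_of_hswL {L T₀ δ θ : ℝ} (hL : 4 ≤ L) (hθ : 0 < θ) (hS : MassAwareSamplingL L δ θ)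
    (hcrit : ∀ κ₀ : ℝ, 0 < κ₀ → κ₀ < 1 / 2 → δ * Phi κ₀ < 8 * Real.pi * θ)
    (hHSW : zetaZeroCount_hasanalizade_shen_wong)
    (hδ : ∀ τ₀ : ℝ, T₀ < τ₀ → 2 * FordFarZeros.hswErr (τ₀ + τ₀ / (8 * Real.pi)) + L / 138 ≤ δ * zdens τ₀)
    (hT : 2 * Real.pi * Real.exp (2 * Real.pi) ≤ T₀) :
    _root_.RiemannHypothesis ↔
      RiemannHypothesisUpTo T₀ ∧ TruncNegEigenvalueBoundedAwayAt (Icc (-1 : ℝ) 1) 1 :=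
  rh_iff_rhUpTo_and_boundedAwayAt_of_ordinateBandL hL hθ hS hcrit
    (ordinateBandL_of_hsw hHSW (le_trans (by
      have := Real.pi_gt_three
      have h1 : (1 : ℝ) ≤ Real.exp (2 * Real.pi) := Real.one_le_exp (by positivity)
      nlinarith) hT) hδ) hT

/-- K-inst₁₀₂₄: `δ = 3/2` satisfies the δ-arithmetic of `ordinateBandL_of_hsw` above `T₀ = e^{1024}` for every cap `Lw ≤ 400`. -/
theorem hswArith_threeHalves_exp1024_L {Lw : ℝ} (hLw : Lw ≤ 400) (τ₀ : ℝ) (hτ : Real.exp 1024 < τ₀) :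
    2 * FordFarZeros.hswErr (τ₀ + τ₀ / (8 * Real.pi)) + Lw / 138 ≤ 3 / 2 * zdens τ₀ := by
  have hπ3 : (3 : ℝ) < Real.pi := Real.pi_gt_three
  have hπ315 : Real.pi < 3.15 := Real.pi_lt_d2
  have hπ0 : 0 < Real.pi := Real.pi_pos
  have hτ0 : 0 < τ₀ := (Real.exp_pos _).trans hτ
  have hL : (1024 : ℝ) ≤ Real.log τ₀ := by
    rw [Real.le_log_iff_exp_le hτ0]; exact hτ.le
  -- the shifted evaluation point `τ₀ + τ₀/8π = τ₀ · (1 + 1/8π)`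
  have hfac : 0 < 1 + 1 / (8 * Real.pi) := by positivity
  have ht' : τ₀ + τ₀ / (8 * Real.pi) = τ₀ * (1 + 1 / (8 * Real.pi)) := by ring
  have hL'eq : Real.log (τ₀ + τ₀ / (8 * Real.pi)) = Real.log τ₀ + Real.log (1 + 1 / (8 * Real.pi)) := by
    rw [ht', Real.log_mul hτ0.ne' hfac.ne']
  have hlf0 : 0 ≤ Real.log (1 + 1 / (8 * Real.pi)) :=
    Real.log_nonneg (by linarith [show 0 < 1 / (8 * Real.pi) from by positivity])
  have hlf1 : Real.log (1 + 1 / (8 * Real.pi)) ≤ 1 / 24 := by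
    have h1 := Real.log_le_sub_one_of_pos hfac
    have h2 : 1 / (8 * Real.pi) ≤ 1 / 24 :=
      one_div_le_one_div_of_le (by norm_num) (by linarith)
    linarith
  set L := Real.log τ₀ with hLdef
  set L' := Real.log (τ₀ + τ₀ / (8 * Real.pi)) with hL'def
  have hL'1 : L ≤ L' := by linarith
  have hL'2 : L' ≤ L + 1 / 24 := by linarith
  have hL'pos : 0 < L' := by linarith
  -- `log L' ≤ 8 log 2 + L'/256 − 1` (tangent of `log` at `256`)
  have hlogL' : Real.log L' ≤ 8 * Real.log 2 + (L' / 256 - 1) := by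
    have h1 : Real.log L' = Real.log 256 + Real.log (L' / 256) := by
      rw [← Real.log_mul (by norm_num) (by positivity)]; congr 1; ring
    have h2 : Real.log (256 : ℝ) = 8 * Real.log 2 := by
      rw [show (256 : ℝ) = 2 ^ 8 by norm_num, Real.log_pow]; norm_num
    have h3 : Real.log (L' / 256) ≤ L' / 256 - 1 := Real.log_le_sub_one_of_pos (by positivity)
    linarith
  have hlog2 : Real.log 2 < 0.6931471808 := Real.log_two_lt_d9
  have hlog2π : Real.log (2 * Real.pi) ≤ 2 * Real.pi - 1 := Real.log_le_sub_one_of_pos (by positivity)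
  -- both sides in terms of `L`, `L'`
  have hz : zdens τ₀ = (L - Real.log (2 * Real.pi)) / (2 * Real.pi) := by
    unfold zdens; rw [Real.log_div hτ0.ne' (by positivity)]
  have hq : FordFarZeros.hswErr (τ₀ + τ₀ / (8 * Real.pi)) = 0.1038 * L' + 0.2573 * Real.log L' + 9.3675 := by
    rw [hL'def]; rfl
  rw [hz, hq]
  set X := (L - Real.log (2 * Real.pi)) / (2 * Real.pi) with hXdef
  have hX : 2 * Real.pi * X = L - Real.log (2 * Real.pi) := by
    rw [hXdef]; field_simp
  have hXnn : 0 ≤ X := by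
    rw [hXdef]; exact div_nonneg (by linarith) (by positivity)
  have hXpi : Real.pi * X ≤ 3.15 * X := mul_le_mul_of_nonneg_right hπ315.le hXnn
  linarith

/-- Row X-7/HSW_L at `T₀ = e^{1024}`, `δ = 3/2`, cap `4 ≤ L ≤ 400`: `RH ⟺ RH(e^{1024}) ∧ B′₁([−1,1])` modulo `MassAwareSamplingL L (3/2) θ`,
the criterion `(3/2)·Φ(κ₀) < 8πθ` on `(0, ½)` and the HSW print fact.  Conditional bookkeeping. -/
theorem rh_iff_rhUpTo_exp1024_and_boundedAwayAt_L {L θ : ℝ} (hL4 : 4 ≤ L) (hL : L ≤ 400) (hθ : 0 < θ)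
    (hS : MassAwareSamplingL L (3 / 2) θ)
    (hcrit : ∀ κ₀ : ℝ, 0 < κ₀ → κ₀ < 1 / 2 → 3 / 2 * Phi κ₀ < 8 * Real.pi * θ)
    (hHSW : zetaZeroCount_hasanalizade_shen_wong) :
    _root_.RiemannHypothesis ↔
      RiemannHypothesisUpTo (Real.exp 1024) ∧ TruncNegEigenvalueBoundedAwayAt (Icc (-1 : ℝ) 1) 1 :=
  rh_iff_rhUpTo_and_boundedAwayAt_of_hswL hL4 hθ hS hcrit hHSW (hswArith_threeHalves_exp1024_L hL) (by
    have h1 : 2 * Real.pi ≤ Real.exp (2 * Real.pi) := by linarith [Real.add_one_le_exp (2 * Real.pi)]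
    have h2 : Real.exp (2 * Real.pi) * Real.exp (2 * Real.pi) = Real.exp (4 * Real.pi) := by
      rw [← Real.exp_add]; ring_nf
    have h3 : Real.exp (4 * Real.pi) ≤ Real.exp 1024 := Real.exp_le_exp.mpr (by linarith [Real.pi_lt_d2])
    have h4 : 2 * Real.pi * Real.exp (2 * Real.pi) ≤ Real.exp (2 * Real.pi) * Real.exp (2 * Real.pi) :=
      mul_le_mul_of_nonneg_right h1 (Real.exp_pos _).le
    linarith)

/-- **Row ★₁₀₂₄_L**: for every cap `4 ≤ L ≤ 400` and every `θ ≥ 0.042`, `MassAwareSamplingL L (3/2) θ` and the HSW print fact give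
`RH ⟺ RH(e^{1024}) ∧ B′₁([−1,1])` (`(3/2)·Φ(½) ≤ 1.0515 < 1.0555 ≤ 8π·0.042`).  Gen-10 numerics (card §16): the adversary's worst value
at `δ = 3/2` is `θ_num ≈ 0.30` against the needed `0.042` (margin ≈ 7×), versus `≈ 0.15` against `0.0558` at `δ = 2` (★₄₀₀, ≈ 2.7×).
Conditional bookkeeping; nothing here bears on the truth of RH. -/
theorem rh_iff_rhUpTo_exp1024_and_boundedAwayAt_L' {L θ : ℝ} (hL4 : 4 ≤ L) (hL : L ≤ 400) (hθ : 0.042 ≤ θ)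
    (hS : MassAwareSamplingL L (3 / 2) θ)
    (hHSW : zetaZeroCount_hasanalizade_shen_wong) :
    _root_.RiemannHypothesis ↔
      RiemannHypothesisUpTo (Real.exp 1024) ∧ TruncNegEigenvalueBoundedAwayAt (Icc (-1 : ℝ) 1) 1 :=
  rh_iff_rhUpTo_exp1024_and_boundedAwayAt_L hL4 hL (by linarith) hS
    (crit_of_half (by norm_num) (by
      have h1 := Phi_half_le
      have hπ := Real.pi_gt_d4
      have h2 : 8 * Real.pi * 0.042 ≤ 8 * Real.pi * θ := mul_le_mul_of_nonneg_left hθ (by positivity)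
      linarith)) hHSW

/-- **★₁₀₂₄**: the weakest instantiated residual of the lane, at `(T₀, δ, L) = (e^{1024}, 3/2, 400)`:
`0.042 ≤ θ → MassAwareSamplingL 400 (3/2) θ → HSW → (RH ⟺ RH(e^{1024}) ∧ B′₁([−1,1]))`. -/
theorem rh_iff_rhUpTo_exp1024_and_boundedAwayAt_L400 {θ : ℝ} (hθ : 0.042 ≤ θ) (hS : MassAwareSamplingL 400 (3 / 2) θ)
    (hHSW : zetaZeroCount_hasanalizade_shen_wong) :
    _root_.RiemannHypothesis ↔
      RiemannHypothesisUpTo (Real.exp 1024) ∧ TruncNegEigenvalueBoundedAwayAt (Icc (-1 : ℝ) 1) 1 :=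
  rh_iff_rhUpTo_exp1024_and_boundedAwayAt_L' (by norm_num) le_rfl hθ hS hHSW


end Summit.RiemannHypothesis.RiemannHypothesis.Theorems.Splittings.XWucG8

end
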